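import Summits.AtomisticToContinuum.Crystallization.Theorems.ChartedZeroExcessLayeredLatticeLiouvilleZZZRA

/-!
# lens-2 NODE 85 ZZZR — part 2 of 2 (sequel of `…ChartedZeroExcessLayeredLatticeLiouvilleZZZRA`)

Split for the 400-line cap by the landing lane (hand-2 g41); the module docstring of part 1 (`…ChartedZeroExcessLayeredLatticeLiouvilleZZZRA`) describes the whole node.  Same namespace; all FQNs unchanged.
0 sorry; standard axioms.
-/

noncomputable section
open scoped BigOperators Classical InnerProductSpace RealInnerProductSpace
open MeasureTheory Set Metric Filter Topology
open Literature.Geometry.DiscreteGeometry (IsTwoShellGoodSet)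
open Literature.MathematicalPhysics.StatisticalMechanics (lennardJones card_le_of_separated_of_dist_le)

namespace Summit.AtomisticToContinuum.Crystallization.Theorems.ChartedZeroExcessLayeredLatticeLiouville

open Summit.AtomisticToContinuum.Crystallization.Theorems.ChartedPlanarOrderRigidityDoor (E3 IsClean)
open Summit.AtomisticToContinuum.Crystallization.Theorems.ChartedPlanarOrderDensityDichotomy (μS IsSep)
open Summit.AtomisticToContinuum.Crystallization.Theorems.ChartedPlanarOrderCleanScaleP (IsCleanP IsDoorSetP)
open Summit.AtomisticToContinuum.Crystallization.Theorems.ChartedPlanarOrderMesoCut (LayeredHom EnvClose)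
open Summit.AtomisticToContinuum.Crystallization.Theorems.ChartedPlanarOrderDoorLayeredOsc (IsTwoShellAffineGood)

/-! ### ZZZR-4  (QEᴸ⁺) from the load path; ★ the EXCLUSION DOOR from (OMᴸ); (OMᴸ) from (OGᴸ) or (QCᴸ⁺); the doors of record at the dials -/

section W2Prime

/-- ★★ **(XRᴸ) ∧ (X1ᴸ)(lam > 0) ∧ (X2ᴸ)(0 ≤ sb₁ < sb, 0 ≤ dI₁ < dI, 0 ≤ dB₁ < dB) ⟹ (QEᴸ⁺)** — tree ZZZP `labelSlavedFillingP_of_loadPath` verbatim, keeping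
the inner-tube membership it proves. [this file, g85] -/
theorem labelTubeFillingP_of_loadPath {ϑc ϑ ϑp r rΘ q rsh ρ rm σ ϑr Rs ε rI ℓ ϑ₀ Rg sb dI dB sb₁ dI₁ dB₁ lam aHi Λ θ s : ℝ}
    (hlam : 0 < lam) (hsb : sb₁ < sb) (hdI : dI₁ < dI) (hdB : dB₁ < dB) (hsb₀ : 0 ≤ sb₁) (hdI₀ : 0 ≤ dI₁) (hdB₀ : 0 ≤ dB₁)
    (hR : LabelTubeReferenceP ϑc ϑ ϑp r rΘ q rsh ρ rm σ ϑr Rs ε rI ℓ ϑ₀ Rg sb dI dB aHi Λ θ s)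
    (hC : LabelTubeConvexityP ϑc ϑ ϑp r rΘ q rsh ρ rm σ ϑr Rs ε rI ℓ ϑ₀ Rg sb dI dB lam aHi Λ θ s)
    (hA : LabelLoadedTubeAprioriP ϑc ϑ ϑp r rΘ q rsh ρ rm σ ϑr Rs ε rI ℓ ϑ₀ Rg sb dI dB sb₁ dI₁ dB₁ aHi Λ θ s) :
    LabelTubeFillingP ϑc ϑ ϑp r rΘ q rsh ρ rm σ ϑr Rs ε rI ℓ Rg sb₁ dI₁ dB₁ aHi Λ θ s := by
  intro δ hδ a ha S hS hsum hgood L w hLw x₀ K hKS hKq hmild hcool n xf hxf hrange L' w' U t hCr lab hlab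
  have hy₀ := hR δ hδ a ha S hS hsum hgood L w hLw x₀ K hKS hKq hmild hcool n xf hxf hrange L' w' U t hCr lab hlab
  have hSC := hC δ hδ a ha S hS hsum hgood L w hLw x₀ K hKS hKq hmild hcool n xf hxf hrange L' w' U t hCr lab hlab hy₀
  set y₀ : Fin n → E3 := fun i => lab (xf i) with hy₀def
  have hT₁T : bondTube (S \ coreOf S K ρ) Rg sb₁ dI₁ dB₁ y₀ ⊆ bondTube (S \ coreOf S K ρ) Rg sb dI dB y₀ :=
    bondTube_mono hsb.le hdI.le hdB.le
  have hy₀T₁ : y₀ ∈ bondTube (S \ coreOf S K ρ) Rg sb₁ dI₁ dB₁ y₀ := self_mem_bondTube hsb₀ hdI₀ hdB₀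
  obtain ⟨φ₀, hφ₀, -⟩ := hSC y₀ (hT₁T hy₀T₁)
  have hAp := hA δ hδ a ha S hS hsum hgood L w hLw x₀ K hKS hKq hmild hcool n xf hxf hrange L' w' U t hCr lab hlab hy₀ φ₀ hφ₀
  have hgap : 0 < min ((sb - sb₁) / 4) (min ((dI - dI₁) / 2) ((dB - dB₁) / 2)) :=
    lt_min (by linarith) (lt_min (by linarith) (by linarith))
  obtain ⟨z, hz₁, hz⟩ := exists_hasFDerivAt_zero_of_loadPath
    (E := fun z : Fin n → E3 => clampedEnergy (S \ coreOf S K ρ) z) (D := fun z z' : Fin n → E3 => ∑ i, dist (z i) (z' i) ^ 2)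
    (isCompact_bondTube (hdB₀.trans hdB.le)) convex_bondTube hT₁T hy₀T₁ hgap
    (fun z hz z' hz' => bondTube_margin
      (by linarith [min_le_left ((sb - sb₁) / 4) (min ((dI - dI₁) / 2) ((dB - dB₁) / 2))])
      (by linarith [(min_le_right ((sb - sb₁) / 4) (min ((dI - dI₁) / 2) ((dB - dB₁) / 2))).trans (min_le_left _ _)])
      (by linarith [(min_le_right ((sb - sb₁) / 4) (min ((dI - dI₁) / 2) ((dB - dB₁) / 2))).trans (min_le_right _ _)]) hz hz')
    hlam (fun z z' => norm_sub_sq_le_sum_dist_sq z z') hφ₀ hSC hAp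
  obtain ⟨hinj, hdisj, htame⟩ := hy₀.2 z (hT₁T hz₁)
  exact ⟨z, hz₁, hinj, hdisj, hz, htame⟩

/-- ★★★ **THE EXCLUSION DOOR (PROVED): (SC) ∧ (GL₂) ∧ (XRᴸ) ∧ (OMᴸ) ⟹ [MCMCᶜ]** (`0 ≤ ρ`).  The grand-clamped-minimising core, enumerated, lies in the outer
tube about its label image by (OMᴸ); every member of that tube is `ϑ`-tame against the glued configuration by (XRᴸ); the glued configuration is `S`.
NO filling, NO convexity, NO coercivity is used. [this file, g85] -/
theorem mildCoolMoatClampedCoreP_of_minInLabelTube {ϑc ϑ ϑp r rΘ q rsh ρ rm σ ϑr Rs ε rI ℓ ϑ₀ Rg sb dI dB aHi Λ θ s : ℝ} (hρ : 0 ≤ ρ)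
    (hSC : CoolZoneShadowCrystalP ϑc ϑp r q rsh rm σ ϑr Rs ε rI ℓ aHi Λ θ s)
    (hGL : BondLabelP₂ ϑc ϑp r rΘ q rsh rm σ ϑr Rs ε rI ℓ aHi Λ θ s)
    (hR : LabelTubeReferenceP ϑc ϑ ϑp r rΘ q rsh ρ rm σ ϑr Rs ε rI ℓ ϑ₀ Rg sb dI dB aHi Λ θ s)
    (hM : MinInLabelTubeP ϑc ϑp r rΘ q rsh ρ rm σ ϑr Rs ε rI ℓ Rg sb dI dB aHi Λ θ s) :
    MildCoolMoatClampedCoreP ϑc ϑ ϑp r q rsh ρ rm aHi Λ θ s := by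
  intro δ hδ a ha S hS hsum hgood L w hLw x₀ K hKS hKq hmild hcool hmin
  have hKf : K.Finite :=
    (Literature.Probability.Process.LocalConfig.finite_inter_of_separated hδ hS.2.1 (isCompact_closedBall x₀ q)).subset
      fun k hk => ⟨mem_closedBall.2 (hKq k hk), hKS hk⟩
  obtain ⟨n, f, hf⟩ := (coreOf_finite hδ hS.2.1 hKf ρ).fin_embedding
  obtain ⟨L', w', U, t, hCr⟩ := hSC δ hδ a ha S hS hsum hgood L w hLw x₀ K hKS hKq hmild hcool
  obtain ⟨lab, hlab⟩ := hGL δ hδ a ha S hS hsum hgood L w hLw x₀ K hKS hKq hmild hcool L' w' U t hCr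
  have hfT := hM δ hδ a ha S hS hsum hgood L w hLw x₀ K hKS hKq hmild hcool hmin n f f.injective hf L' w' U t hCr lab hlab
  have hy₀ := hR δ hδ a ha S hS hsum hgood L w hLw x₀ K hKS hKq hmild hcool n f f.injective hf L' w' U t hCr lab hlab
  have htame := (hy₀.2 f hfT).2.2
  have hglued : (S \ coreOf S K ρ) ∪ Set.range ⇑f = S := by rw [hf, sdiff_union_of_subset (coreOf_subset S K ρ)]
  intro k hk
  have hkcore : k ∈ coreOf S K ρ := ⟨hKS hk, k, hk, by rw [dist_self]; exact hρ⟩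
  rw [← hf] at hkcore
  obtain ⟨i, hi⟩ := hkcore
  have ht := htame i
  rw [hglued] at ht
  rw [← hi]
  exact ht

/-- ★★ **THE ENERGETIC SUFFICIENT ROUTE (PROVED): (QEᴸ⁺) ∧ (OGᴸ)(g₀ > 0) ⟹ (OMᴸ)** — an off-tube grand minimiser would sit `g₀` above the inner-tube
critical filling, which is one of its own grand-canonical competitors (same count). [this file, g85] -/
theorem minInLabelTubeP_of_gap {ϑc ϑ ϑp r rΘ q rsh ρ rm σ ϑr Rs ε rI ℓ Rg sb dI dB sb₁ dI₁ dB₁ g₀ aHi Λ θ s : ℝ} (hg₀ : 0 < g₀)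
    (hE : LabelTubeFillingP ϑc ϑ ϑp r rΘ q rsh ρ rm σ ϑr Rs ε rI ℓ Rg sb₁ dI₁ dB₁ aHi Λ θ s)
    (hOG : OffTubeGapP ϑc ϑ ϑp r rΘ q rsh ρ rm σ ϑr Rs ε rI ℓ Rg sb dI dB sb₁ dI₁ dB₁ g₀ aHi Λ θ s) :
    MinInLabelTubeP ϑc ϑp r rΘ q rsh ρ rm σ ϑr Rs ε rI ℓ Rg sb dI dB aHi Λ θ s := by
  intro δ hδ a ha S hS hsum hgood L w hLw x₀ K hKS hKq hmild hcool hmin n xf hxf hrange L' w' U t hCr lab hlab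
  by_contra hoff
  obtain ⟨y, hyT, hyinj, hydisj, hcrit, htame⟩ :=
    hE δ hδ a ha S hS hsum hgood L w hLw x₀ K hKS hKq hmild hcool n xf hxf hrange L' w' U t hCr lab hlab
  have hgap := hOG δ hδ a ha S hS hsum hgood L w hLw x₀ K hKS hKq hmild hcool n xf hxf hrange L' w' U t hCr lab hlab hoff y hyT hyinj hydisj
    hcrit htame
  have hmin' := hmin n xf hxf hrange n y hyinj hydisj
  linarith

/-- ★★ **THE COERCIVE SUFFICIENT ROUTE (PROVED): (QEᴸ⁺) ∧ (QCᴸ⁺)(κ > 0) ⟹ (OMᴸ)** (inner radii at most the outer ones) — row 1540's coercivity forces the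
grand minimiser to BE the inner-tube filling, which lies in the outer tube. [this file, g85] -/
theorem minInLabelTubeP_of_coercivity {ϑc ϑ ϑp r rΘ q rsh ρ rm σ ϑr Rs ε rI ℓ Rg sb dI dB sb₁ dI₁ dB₁ κ aHi Λ θ s : ℝ} (hκ : 0 < κ)
    (hsb : sb₁ ≤ sb) (hdI : dI₁ ≤ dI) (hdB : dB₁ ≤ dB)
    (hE : LabelTubeFillingP ϑc ϑ ϑp r rΘ q rsh ρ rm σ ϑr Rs ε rI ℓ Rg sb₁ dI₁ dB₁ aHi Λ θ s)
    (hC : LabelTubeCoercivityP ϑc ϑ ϑp r rΘ q rsh ρ rm σ ϑr Rs ε rI ℓ Rg sb₁ dI₁ dB₁ κ aHi Λ θ s) :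
    MinInLabelTubeP ϑc ϑp r rΘ q rsh ρ rm σ ϑr Rs ε rI ℓ Rg sb dI dB aHi Λ θ s := by
  intro δ hδ a ha S hS hsum hgood L w hLw x₀ K hKS hKq hmild hcool hmin n xf hxf hrange L' w' U t hCr lab hlab
  obtain ⟨y, hyT, hyinj, hydisj, hcrit, htame⟩ :=
    hE δ hδ a ha S hS hsum hgood L w hLw x₀ K hKS hKq hmild hcool n xf hxf hrange L' w' U t hCr lab hlab
  have hineq :=
    hC δ hδ a ha S hS hsum hgood L w hLw x₀ K hKS hKq hmild hcool n xf hxf hrange L' w' U t hCr lab hlab y hyT hyinj hydisj hcrit htame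
  have hmin' := hmin n xf hxf hrange n y hyinj hydisj
  have hsum0 : ∑ i, dist (xf i) (y i) ^ 2 ≤ 0 := by nlinarith
  have hzero : ∀ i, dist (xf i) (y i) ^ 2 = 0 := fun i =>
    (Finset.sum_eq_zero_iff_of_nonneg fun j _ => by positivity).1
      (le_antisymm hsum0 (Finset.sum_nonneg fun j _ => by positivity)) i (Finset.mem_univ i)
  have hyf : xf = y := funext fun i => dist_eq_zero.1 (pow_eq_zero_iff two_ne_zero |>.1 (hzero i))
  subst hyf
  exact bondTube_mono hsb hdI hdB hyT

/-- ★★★ **THE DOOR OF RECORD OF THIS GENERATION (PROVED modulo TWO hypotheses): `[MCMC](ϑc)` ⟸ (SC) ∧ (OMᴸ)(Rg, sb, dI, dB)** at the docket geometry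
`(ϑp, r, rΘ, q, rsh, ρ, rm) = (1/10, 8, 145/16, 4, 12, 16, 16)`, shadow dials `(σ, ϑr, Rs, ε, rI, ℓ) = (17/20, 10⁻⁴, 5, 10⁻⁴, 10, 43/2)`, `(aHi, Λ, θ, s) = (1, 2,
1/16, 1/50)`, door level `tameRadius`; the outer tube radii range over the polytope in which ZZZQ certifies (XRᴸ) (`labelTubeReferenceP_record`); (GL₂)
by tree ZZZK.  Row 1540's four open hypotheses (SC) ∧ (X1ᴸ) ∧ (X2ᴸ) ∧ (QCᴸ) are replaced by TWO, the second implied by them (PROVED). [this file, g85] -/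
theorem mildCoolMoatCorePG_OM_record {ϑc ϑ₀ Rg sb dI dB : ℝ} (hdB₀ : 0 ≤ dB) (h2dB : 2 * dB < 17 / 20) (hRg : 4 + 2 * dB ≤ Rg)
    (hRs : 4 + 2 * dB + 1 / 10000 ≤ 5) (hfit : 16 + 1 / 10000 + Rg < 43 / 2) (hdIσ : dI + 1 / 10000 < 17 / 20)
    (hϑ₀ : (1 : ℝ) / 10000 + 1 / 10000 ≤ ϑ₀) (hϑ : ϑ₀ + max sb dI ≤ tameRadius)
    (hSC : CoolZoneShadowCrystalP ϑc (1 / 10) 8 4 12 16 (17 / 20) (1 / 10000) 5 (1 / 10000) 10 (43 / 2) 1 2 (1 / 16) (1 / 50))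
    (hM : MinInLabelTubeP ϑc (1 / 10) 8 (145 / 16) 4 12 16 16 (17 / 20) (1 / 10000) 5 (1 / 10000) 10 (43 / 2) Rg sb dI dB 1 2 (1 / 16) (1 / 50)) :
    MildCoolMoatCorePG ϑc tameRadius (1 / 10) 8 4 12 16 1 2 (1 / 16) (1 / 50) :=
  mildCoolMoatCorePG_of_mildClamped
    (mildCoolMoatClampedCoreP_of_minInLabelTube (by norm_num) hSC (bondLabelP₂_record ϑc)
      (labelTubeReferenceP_record ϑc hdB₀ h2dB hRg hRs hfit hdIσ hϑ₀ hϑ) hM)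

/-- ★★ **THE DOOR OF RECORD AT THE FATTEST CERTIFIED TUBE** `(Rg, sb, dI, dB) = (121/25, 249/5000, 249/5000, 21/50)` (`ϑ₀ = 1/5000`): `[MCMC](ϑc)` ⟸ (SC) ∧
(OMᴸ)(121/25, 249/5000, 249/5000, 21/50) — bonds of `4.84`-pairs coherent to `0.0498`, collar-facing sites to `0.0498`, all sites to `0.42`. [this file, g85] -/
theorem mildCoolMoatCorePG_OM_fat {ϑc : ℝ}
    (hSC : CoolZoneShadowCrystalP ϑc (1 / 10) 8 4 12 16 (17 / 20) (1 / 10000) 5 (1 / 10000) 10 (43 / 2) 1 2 (1 / 16) (1 / 50))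
    (hM : MinInLabelTubeP ϑc (1 / 10) 8 (145 / 16) 4 12 16 16 (17 / 20) (1 / 10000) 5 (1 / 10000) 10 (43 / 2) (121 / 25) (249 / 5000) (249 / 5000)
      (21 / 50) 1 2 (1 / 16) (1 / 50)) :
    MildCoolMoatCorePG ϑc tameRadius (1 / 10) 8 4 12 16 1 2 (1 / 16) (1 / 50) :=
  mildCoolMoatCorePG_OM_record (ϑ₀ := 1 / 5000) (by norm_num) (by norm_num) (by norm_num) (by norm_num) (by norm_num) (by norm_num) (by norm_num)
    (by rw [max_self]; norm_num [tameRadius]) hSC hM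

/-- ★★ **THE W2′ DOOR (PROVED modulo its four hypotheses): `[MCMC](ϑc)` ⟸ (SC) ∧ (X1ᴸ)(lam > 0) ∧ (X2ᴸ)(radii) ∧ (OGᴸ)(g₀ > 0)** at the record dials — row
1540's door with (QCᴸ) REPLACED by the strictly weaker (OGᴸ), through (QEᴸ⁺) (`labelTubeFillingP_of_loadPath`) and (OMᴸ) (`minInLabelTubeP_of_gap`).
[this file, g85] -/
theorem mildCoolMoatCorePG_W2'_record {ϑc ϑ₀ Rg sb dI dB sb₁ dI₁ dB₁ lam g₀ : ℝ}
    (hlam : 0 < lam) (hg₀ : 0 < g₀) (hsb : sb₁ < sb) (hdI : dI₁ < dI) (hdB : dB₁ < dB) (hsb₀ : 0 ≤ sb₁) (hdI₀ : 0 ≤ dI₁) (hdB₀ : 0 ≤ dB₁)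
    (h2dB : 2 * dB < 17 / 20) (hRg : 4 + 2 * dB ≤ Rg) (hRs : 4 + 2 * dB + 1 / 10000 ≤ 5) (hfit : 16 + 1 / 10000 + Rg < 43 / 2)
    (hdIσ : dI + 1 / 10000 < 17 / 20) (hϑ₀ : (1 : ℝ) / 10000 + 1 / 10000 ≤ ϑ₀) (hϑ : ϑ₀ + max sb dI ≤ tameRadius)
    (hSC : CoolZoneShadowCrystalP ϑc (1 / 10) 8 4 12 16 (17 / 20) (1 / 10000) 5 (1 / 10000) 10 (43 / 2) 1 2 (1 / 16) (1 / 50))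
    (hX1 : LabelTubeConvexityP ϑc tameRadius (1 / 10) 8 (145 / 16) 4 12 16 16 (17 / 20) (1 / 10000) 5 (1 / 10000) 10 (43 / 2) ϑ₀ Rg sb dI dB
      lam 1 2 (1 / 16) (1 / 50))
    (hX2 : LabelLoadedTubeAprioriP ϑc tameRadius (1 / 10) 8 (145 / 16) 4 12 16 16 (17 / 20) (1 / 10000) 5 (1 / 10000) 10 (43 / 2) ϑ₀ Rg sb dI
      dB sb₁ dI₁ dB₁ 1 2 (1 / 16) (1 / 50))
    (hOG : OffTubeGapP ϑc tameRadius (1 / 10) 8 (145 / 16) 4 12 16 16 (17 / 20) (1 / 10000) 5 (1 / 10000) 10 (43 / 2) Rg sb dI dB sb₁ dI₁ dB₁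
      g₀ 1 2 (1 / 16) (1 / 50)) :
    MildCoolMoatCorePG ϑc tameRadius (1 / 10) 8 4 12 16 1 2 (1 / 16) (1 / 50) :=
  have hR := labelTubeReferenceP_record ϑc (hdB₀.trans hdB.le) h2dB hRg hRs hfit hdIσ hϑ₀ hϑ
  mildCoolMoatCorePG_OM_record (hdB₀.trans hdB.le) h2dB hRg hRs hfit hdIσ hϑ₀ hϑ hSC
    (minInLabelTubeP_of_gap hg₀ (labelTubeFillingP_of_loadPath hlam hsb hdI hdB hsb₀ hdI₀ hdB₀ hR hX1 hX2) hOG)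

/-- ★★ **THE W2′ DOOR AT THE ROW-1237 TUBE MARKS** `(ϑ₀, Rg, sb, dI, dB) = (1/400, 5, 3/400, 3/400, 3/10)`: `[MCMC](ϑc)` ⟸ (SC) ∧ (X1ᴸ)(lam > 0) ∧
(X2ᴸ)(0 ≤ sb₁ < 3/400, 0 ≤ dI₁ < 3/400, 0 ≤ dB₁ < 3/10) ∧ (OGᴸ)(g₀ > 0). [this file, g85] -/
theorem mildCoolMoatCorePG_W2'_marks {ϑc sb₁ dI₁ dB₁ lam g₀ : ℝ} (hlam : 0 < lam) (hg₀ : 0 < g₀) (hsb : sb₁ < 3 / 400) (hdI : dI₁ < 3 / 400)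
    (hdB : dB₁ < 3 / 10) (hsb₀ : 0 ≤ sb₁) (hdI₀ : 0 ≤ dI₁) (hdB₀ : 0 ≤ dB₁)
    (hSC : CoolZoneShadowCrystalP ϑc (1 / 10) 8 4 12 16 (17 / 20) (1 / 10000) 5 (1 / 10000) 10 (43 / 2) 1 2 (1 / 16) (1 / 50))
    (hX1 : LabelTubeConvexityP ϑc tameRadius (1 / 10) 8 (145 / 16) 4 12 16 16 (17 / 20) (1 / 10000) 5 (1 / 10000) 10 (43 / 2) (1 / 400) 5
      (3 / 400) (3 / 400) (3 / 10) lam 1 2 (1 / 16) (1 / 50))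
    (hX2 : LabelLoadedTubeAprioriP ϑc tameRadius (1 / 10) 8 (145 / 16) 4 12 16 16 (17 / 20) (1 / 10000) 5 (1 / 10000) 10 (43 / 2) (1 / 400) 5
      (3 / 400) (3 / 400) (3 / 10) sb₁ dI₁ dB₁ 1 2 (1 / 16) (1 / 50))
    (hOG : OffTubeGapP ϑc tameRadius (1 / 10) 8 (145 / 16) 4 12 16 16 (17 / 20) (1 / 10000) 5 (1 / 10000) 10 (43 / 2) 5 (3 / 400) (3 / 400)
      (3 / 10) sb₁ dI₁ dB₁ g₀ 1 2 (1 / 16) (1 / 50)) :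
    MildCoolMoatCorePG ϑc tameRadius (1 / 10) 8 4 12 16 1 2 (1 / 16) (1 / 50) :=
  mildCoolMoatCorePG_W2'_record hlam hg₀ hsb hdI hdB hsb₀ hdI₀ hdB₀ (by norm_num) (by norm_num) (by norm_num) (by norm_num) (by norm_num)
    (by norm_num) (by rw [max_self]; norm_num [tameRadius]) hSC hX1 hX2 hOG

end W2Prime

end Summit.AtomisticToContinuum.Crystallization.Theorems.ChartedZeroExcessLayeredLatticeLiouville

end
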